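import Summits.BirchSwinnertonDyer.BirchSwinnertonDyer.Theses.UniversalToricDescent
import Literature.NumberTheory.EllipticCurves.HeegnerModuleIndex
import Literature.NumberTheory.EllipticCurves.GreenbergSelmer
import Summits.BirchSwinnertonDyer.BirchSwinnertonDyer.Theorems.UniversalToricDescentOneLayerCriterion
import Literature.NumberTheory.EllipticCurves.AnticyclotomicSignedSelmer
import Literature.NumberTheory.EllipticCurves.AnticyclotomicSignedHeegnerClasses
import Literature.NumberTheory.EllipticCurves.IwasawaSelmer
import HarnessLib

/-!
# NODE `residual_omega_kolyvagin` on crux `TwinAlgMuZeroAtThree` (stmt-BirchSwinnertonDyer-24737)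
# — the RESIDUAL Ω-adic Heegner Kolyvagin system (Ω = Λ/3Λ = 𝔽₃⟦T⟧) as the μ-engine at p = 3,
# filed BESIDE the adopted line `beta-road` (LEAD utd-p1 g21 @8c58e2fed7f0, director (416) 16:20:32Z)

cruxidea `cruxidea-stmt-BirchSwinnertonDyer-24737-1-g0` (gen 0, 2026-08-29). NODE in the sense of D-0171: a compiling
skeleton whose composition `TwinAlgMuZeroAtThree_of` concludes the ROUTE DECL BY NAME from SIX stubs (three per kernel
bucket), every piece tagged COSTUME / WEAKER / UNDECIDED with evidence, every leaf tagged ATTACKABLE / INSTRUMENTABLE /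
IDEA-NEEDED. No EQUIV layer: the root split `PieceB ∧ PieceC0 → crux` is the crux's own disjunction (each piece
strictly WEAKER — one bucket), and inside a bucket the three stubs are an ∃-supply (K1), an implication with a new,
strictly intermediate conclusion (R1) and a μ-only transfer implication (T1).

ALIGNMENT WITH `beta-road` (pen's cut (b), binding): `PieceC0` is VERBATIM the statement of beta-road's opaque C₀
residual `stub_goodSS` — so `pieceC0_of : K1_C → R1_C → T1_C → PieceC0` IS the first RESPLIT of `stub_goodSS` (owner =
this idea chain); `PieceB` is VERBATIM the statement of beta-road's `twinAlgMu_mult`, and `pieceB_of` is an ALTERNATIVE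
B-branch WITH NEW CONTENT (beta-road's hardest stub `stub_howardMult` = Howard Thm B's full divisibility
`char X_tors ∣ char(𝔖/κ_∞)²` at `3 ∥ N′` is replaced by the strictly weaker, μ-only `stub_residualKolyvaginMult`; K1 is
beta-road's `stub_localIndivisibleMult` plus the norm-coherence conjunct). Not registered over beta-road's slot:
published as `Lines/residual_omega_kolyvagin.lean` for the triage / crux-plan / LEAD to adopt per bucket.

## The idea in one paragraph (card `Ideas/residual-omega-kolyvagin.md`)

Every print engine for `μ = 0` / `⊇` on the twin at `p = 3` is walled (Howard 2004 `p ∤ N`; Castella 2018 `p > 3`,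
`N⁻ ≠ 1`; Castella–Wan 2024 `p ≥ 5`; BCS 2025 / Hsieh Thm B `3 ∤ N′`), and g51's road (`local-indivisibility-road`)
still routes the algebraic `μ` through Howard's FULL characteristic-ideal divisibility `char X_tors ∣ char(S/κ_∞)²`
at `p = 3 ∣ N′` (its K2 `HowardDivisibilityMultThree`: all height-one primes, Thm 3.3.7, Cornut–Vatsal, `p ∤ h_K`,
Manin). The lever here: `μ` is ONE height-one prime, `𝔓 = 3Λ`, and Howard's Kolyvagin-system machine (Howard 2004
§2, written for any complete Noetherian local coefficient ring; Thm 2.6.1 for a DVR; §2.5 principal Artinian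
quotients) can be run DIRECTLY over the equicharacteristic DVR `Ω := Λ/3Λ = 𝔽₃⟦T⟧` on `T_Ω := E′[3] ⊗ Ω(Ψ)` —
the one localisation Howard never takes (he specialises at `𝔮_m = (T^m + p)`, never at `pΛ`). Over `Ω`:
(i) `T_Ω / T^{3ⁿ} T_Ω = Ind_{K_n}^K E′[3]`, `H¹(K, A_Ω) = H¹(K_∞, E′[3])`, so the Ω-corank of the residual Selmer
group IS `rank_Λ + (number of μ-summands)` of `X(E′/K_∞)`; (ii) the Kolyvagin primes of EVERY depth `k` are ONE
Chebotarev class `{ℓ inert in K : Frob_ℓ ~ τ on E′[3]}` (the map `ℤ → Ω` factors through `𝔽₃`, and inert `λ = ℓ𝒪_K`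
splits completely in `K_∞`, so `Frob_λ` acts on `T_Ω/T^k` through `E′[3]` alone) — no `3^k ∣ ℓ + 1, a_ℓ` towers,
and `Literature.Barriers.BirchSwinnertonDyer.NoAdmissiblePrimesAtThree` (level-raising primes) is not in play;
(iii) hypotheses H.0–H.5 need only `ρ̄ : G_ℚ ↠ GL₂(𝔽₃)` (H.2 = `H¹(GL₂(𝔽₃), 𝔽₃²) = 0`, tree p719731
`subsingleton_H1_GL2_zmod3_std`; `K ∩ ℚ(E′[3]) = ℚ` as `d_K` odd and `3` unramified in `K`), never `3`-ADIC
surjectivity, never `p ∤ N′`; (iv) the input "`κ̄₁ ≠ 0` in `H¹(K, T_Ω)`" is EXACTLY `κ_∞ ∉ 3·H̃¹(K, 𝕋)`, implied by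
the finite-layer LOCAL indivisibility `(β)` (g51 K1 `LocalIndivisibleLayer`, engines g56 Serre–Tate–Coleman cube on B,
g57 signed Newton on C₀). Output of Thm 2.6.1 over `Ω`: the residual Greenberg (B) / signed (C₀) Selmer group has
Ω-corank ONE, i.e. `rank_Λ X_Gr = 1 ∧ μ(X_Gr,tors) = 0` — stub R1, conclusion `ResidualCorankLeOne`. The passage to the
crux's `X_(∅ at 𝔭, 0 at 𝔭′)` is μ-only Poitou–Tate bookkeeping (stub T1): `μ(X_(∅,0)) ≤ μ(X_Gr,tors) +
2·μ(H¹_Gr(K_𝔭,𝕋)/Λ·loc_𝔭 κ_∞)` (the `𝔭′`-term equals the `𝔭`-term by τ-symmetry of `𝔖 = H¹_Gr(K,𝕋)`, Castella 2017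
App. A (A.5)–(A.7) = beta-road's `stub_twoSidedPackageMult`), vanishing by `(β)` at `𝔭` in the free rank-one local
module (g51 L1 `freeRankOneIndivisible`, LANDED p720585); then the LANDED one-layer
criterion (p725052) turns "`Sel[3]` has few layer invariants" into the crux's conclusion verbatim.

## Pieces, tags, leaves (D-0171)

ROOT SPLIT `PieceB ∧ PieceC0 → TwinAlgMuZeroAtThree` (`TwinAlgMuZeroAtThree_of_pieces`, proved): each piece = the crux
restricted to one disjunct of its bucket guard — WEAKER (evidence: disjoint hypotheses `Mult W′ 3` vs `GoodSS W′ 3`;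
neither piece alone gives the crux: the other bucket is non-empty, habitats 15a1/ℚ(√−11) (B), 17a1/ℚ(√−35) (C₀),
LEAD memo `LEAD-utd-p1-g20-support-and-buckets.md`).
Bucket B (`Mult W′ 3 ∧ 3 ∤ v₃(Δ′)`):
* `stub_betaPairMult : BetaPairMultThree` — ∃ a guarded (`3 ∤ c`), `a₃`-norm-coherent Heegner family with `(β)` at `𝔭`
  (= beta-road's `stub_localIndivisibleMult` ∧ norm-coherence). UNDECIDED (no print at `3 ∥ N′`; Cornut–Vatsal give GLOBAL indivisibility only, g53 audit item 3);
  leaf INSTRUMENTABLE (instrument asks Q-BETA-1/2 of g51 on 15a1/ℚ(√−11), engine card `serre-tate-coleman-cube` g56: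
  unit-root/Dwork `(β)`; data not yet returned — cell INBOX tag bsd-frontier-data).
* `stub_residualKolyvaginMult : ResidualKolyvaginMultThree` — `(β)@𝔭` ⟹ `ResidualCorankLeOne (Sel(K_∞,E′[3^∞]))`.
  UNDECIDED (the Ω-adic Kolyvagin system at `3 ∥ N′`: Kolyvagin derivative classes of mixed-conductor Heegner points,
  vertical relation `Tr z_{j+1} = a₃ z_j` via `U₃`; the self-dual cartesian residual local condition at `v ∣ 3` =
  image of `H¹(K_v, Fil ⊗ Ω(Ψ))`, `Fil` the `μ₃^∞`-line of the Tate curve, propagated from `T_Ω ⊗ 𝔽₃((T))`);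
  leaf IDEA = THIS card (live round, cruxidea-24737-1 g0). Strictly WEAKER than g51 K2 `HowardDivisibilityMultThree`
  (μ at one height-one prime vs the full divisibility).
* `stub_residualTransferMult : ResidualTransferMultThree` — `(β)@𝔭`, `ResidualCorankLeOne(Sel_Gr)` ⟹ ONE layer of `Sel_(∅ at 𝔭, 0 at 𝔭′)[3]` has `< 3^{3ⁿ}` invariants. WEAKER (an implication between Selmer data;
  evidence: it is the μ-part of the char-ideal transfer `char X_(∅,0) = char X_Gr,tors · char(H¹_Gr(K_𝔭,𝕋)/loc S)²·unit`,
  Castella 2017 JLMS Thm. 1.3-shape / BCK 2021 §5, pure Poitou–Tate); leaf ATTACKABLE (tree: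
  `SchneiderFreeAdditiveX3.PoitouTateReduction.poitouTate_selmerStructure_duality_holds` p624636, g51 L1 p720585,
  one-layer criterion p725052).
Bucket C₀ (`GoodSS W′ 3 ∧ a₃ = 0`): the same three with SIGNED objects — `stub_betaPairGoodSS` (∃ guarded
trace-coherent family and a sign `ε` with g57's `SignedLayerIndivisible` at `𝔭`; UNDECIDED, INSTRUMENTABLE:
Q-BETA-C₀ of g57 on 17a1/ℚ(√−35), engine `height-two-newton-signed-beta` = g57 `BetaEngineGoodSSApZeroThree` at `𝔭`),
`stub_residualKolyvaginGoodSS` (signed residual KS ⟹ `ResidualCorankLeOne` of the discrete signed Selmer group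
`AcSigned.selmer … (sgn ε, sgn ε)`; UNDECIDED, IDEA = this card: Castella–Wan Thm A.4/A.5 run over `Ω` with B.-D. Kim's
self-dual `±` conditions, port `p = 3`), `stub_residualTransferGoodSS` (WEAKER, ATTACKABLE: Castella–Wan 2024 §5
Lemma 5.? (rel,str) ↔ (±,±) passage, μ-part only).

## Costume / shredding self-audit
No stub restates the crux, the summit, or a refuted statement (negatives index: stmt-15532, stmt-24881 — neither is a
Selmer/Heegner statement of this shape); no stub is bookkeeping-only (T1 is the Poitou–Tate transfer — M-sized, with
three landed inputs; K1/R1 are research). The ∀F-pieces all carry the typed guard `¬ 3 ∣ F.Dt.c` (g56 lesson: `F ↦ 3F`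
kills any unguarded `(β)`) and the coherence binder; `(β)` is asked at the degree-one `𝔭` only, the `𝔭′`-side
being paid by τ-symmetry exactly as in beta-road's two-sided package. Disproof.lean: none published for 24737 at filing time (`ledger crux ls`, 2026-08-29).
-/

open scoped Classical

namespace Summit.BirchSwinnertonDyer.BirchSwinnertonDyer.Cruxes.TwinAlgMuZeroAtThree.ResidualOmegaKolyvagin

open NumberField IsDedekindDomain Field WeierstrassCurve
open Literature.NumberTheory.EllipticCurves Literature.NumberTheory.EllipticCurves.GreenbergSelmer
open Summit.BirchSwinnertonDyer.Rank1Residual.X11b Summit.BirchSwinnertonDyer.Rank1Residual.X11b.AcSelmer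

universe u

/-! ## §0 Vocabulary (three small predicates; everything else is tree vocabulary) -/

section Vocabulary

variable {K : Type} [Field K] [NumberField K]

/-- **`a`-norm-coherence of a Heegner family at a prime `p ∥ N` of the level** (`a = a_p(E) ∈ {±1}`):
`Tr_{K_{n+1}/K_n}(z_{n+1}) = a • z_n` for all `n ≥ 0`, traces as sums over a transversal (as in the tree's
`HeegnerFamily.IsTraceCoherentApZero`). The vertical distribution relation of mixed-conductor Heegner points
(`U_p x_{n+1} = Tr x_{n+2}` on `X₀(N)`, `p ∣ N`, downward `p`-level structure) pushed to `E′`, where `U_p = a_p`. -/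
def IsNormCoherentMult {N : ℕ} [NeZero N] {W : WeierstrassCurve ℚ} {κ : ZpExtension K 3}
    {jbar : AlgebraicClosure K →+* ℂ} (F : HeegnerFamily N W K κ jbar) (a : ℤ) : Prop :=
  ∀ (n : ℕ) (R : Finset (absoluteGaloisGroup K)),
    (↑R ⊆ (κ.layerSubgroup n : Set (absoluteGaloisGroup K))) →
    (∀ τ ∈ κ.layerSubgroup n, ∃! r, r ∈ R ∧ r⁻¹ * τ ∈ κ.layerSubgroup (n + 1)) →
      ∑ r ∈ R, r • F.z (n + 1) = a • F.z n

/-- **Layer-`k` local `3`-indivisibility at `𝔭`** — VERBATIM the text of g57's `SignedNewtonBeta.LayerIndivisibleAt`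
(`Cruxes/TwinAlgMuZeroAtThree/SketchHeightTwoNewtonSignedBetaG57.lean`; copied, not imported: crux sketch modules are
not in the farm's build closure): every `3`-division point `Q` of the layer point `z_k`, `(3)Q = z_k`, has NON-ZERO
Kummer class over `K_{k,𝔭}` (the subgroup `layerSubgroup k ⊓ decomp 𝔭`), i.e. `z_k ∉ 3·E′(K_{k,𝔭})`. -/
def LayerIndivisibleAt {N' : ℕ} [NeZero N'] (W' : WeierstrassCurve ℚ) (K : Type) [Field K]
    [NumberField K] (κ : ZpExtension K 3) (jbar : AlgebraicClosure K →+* ℂ)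
    (F : HeegnerFamily N' W' K κ jbar) (𝔭 : HeightOneSpectrum (𝓞 K)) (k : ℕ) : Prop :=
  ∀ (Q : geomPoints (W'.baseChange K))
    (hQ : ∀ σ ∈ κ.layerSubgroup k ⊓ decomp 𝔭, σ • ((3 : ℤ) • Q) = (3 : ℤ) • Q),
    (3 : ℤ) • Q = F.z k →
      (W'.baseChange K).kummerClassOver (κ.layerSubgroup k ⊓ decomp 𝔭) 3 Q hQ ≠ 0

/-- **`(β)` — SOME layer point is locally `3`-indivisible at `𝔭`**: VERBATIM the text of g51's K1
`LocalIndivisibilityRoad.LocalIndivisibleLayer` (`Cruxes/TwinAlgMuZeroAtThree/SketchLocalIndivisibilityRoad.lean`) =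
g57's copy; `Iff.rfl` with either once those modules are importable. -/
def LocalIndivisibleLayer {N' : ℕ} [NeZero N'] (W' : WeierstrassCurve ℚ) (K : Type) [Field K]
    [NumberField K] (κ : ZpExtension K 3) (jbar : AlgebraicClosure K →+* ℂ)
    (F : HeegnerFamily N' W' K κ jbar) (𝔭 : HeightOneSpectrum (𝓞 K)) : Prop :=
  ∃ k : ℕ, LayerIndivisibleAt W' K κ jbar F 𝔭 k

/-- **Signed layer indivisibility** — VERBATIM the text of g57's `SignedNewtonBeta.SignedLayerIndivisible`: for the
sign `ε`, layer points `z_k` of parity `ε` are locally `3`-indivisible at `𝔭` for infinitely many `k`. -/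
def SignedLayerIndivisible {N' : ℕ} [NeZero N'] (W' : WeierstrassCurve ℚ) (K : Type) [Field K]
    [NumberField K] (κ : ZpExtension K 3) (jbar : AlgebraicClosure K →+* ℂ)
    (F : HeegnerFamily N' W' K κ jbar) (𝔭 : HeightOneSpectrum (𝓞 K)) (ε : ℤˣ) : Prop :=
  ∀ k₀ : ℕ, ∃ k : ℕ, k₀ ≤ k ∧ (-1 : ℤˣ) ^ k = ε ∧ LayerIndivisibleAt W' K κ jbar F 𝔭 k

/-- Bookkeeping (proved): signed layer indivisibility for any one sign gives `(β)`. -/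
theorem localIndivisibleLayer_of_signed {N' : ℕ} [NeZero N'] {W' : WeierstrassCurve ℚ} {K : Type}
    [Field K] [NumberField K] {κ : ZpExtension K 3} {jbar : AlgebraicClosure K →+* ℂ}
    {F : HeegnerFamily N' W' K κ jbar} {𝔭 : HeightOneSpectrum (𝓞 K)} {ε : ℤˣ}
    (h : SignedLayerIndivisible W' K κ jbar F 𝔭 ε) : LocalIndivisibleLayer W' K κ jbar F 𝔭 := by
  obtain ⟨k, -, -, hk⟩ := h 0
  exact ⟨k, hk⟩

variable (W : WeierstrassCurve K) (κ : ZpExtension K 3)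

/-- **Residual Ω-corank ≤ 1** of a `Γ`-stable subgroup `Sel ⊆ H¹(K_∞, E[3^∞])` (`Ω = 𝔽₃⟦T⟧`): the layer-`n`
invariants of `Sel[3]` (classes killed by `3` and fixed by `conj_{γ^{3ⁿ}}`) are finite of order `≤ 3^{3ⁿ + C}` for a
constant `C` — i.e. `Sel[3]^∨` is a finitely generated `Ω`-module of rank `≤ 1`; for `Sel = Sel_Gr(K_∞, E[3^∞])` this
says `rank_Λ X + #(μ-summands of X) ≤ 1`. -/
def ResidualCorankLeOne (Sel : AddSubgroup (W.subgroupH1 3 κ.kerSubgroup)) (γ : absoluteGaloisGroup K) : Prop :=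
  ∃ C : ℕ, ∀ n : ℕ,
    Set.Finite {s : Sel | 3 • s = 0 ∧ W.conjH1 3 κ.kerSubgroup (γ ^ 3 ^ n) s = s} ∧
      Nat.card {s : Sel // 3 • s = 0 ∧ W.conjH1 3 κ.kerSubgroup (γ ^ 3 ^ n) s = s} ≤ 3 ^ (3 ^ n + C)

/-- **One small layer** of `Sel[3]`: for SOME `n` the layer-`n` invariants of `Sel[3]` are finite and fewer than
`3^{3ⁿ}` — the hypothesis of the LANDED one-layer criterion
`UniversalToricDescentOneLayerCriterion.isTorsion_and_exists_generator_of_natCard_layerInvariants_lt` (p725052);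
equivalent to `Sel[3]` finite, i.e. residual Ω-corank `0`. -/
def OneSmallLayer (Sel : AddSubgroup (W.subgroupH1 3 κ.kerSubgroup)) (γ : absoluteGaloisGroup K) : Prop :=
  ∃ n : ℕ,
    Set.Finite {s : Sel | 3 • s = 0 ∧ W.conjH1 3 κ.kerSubgroup (γ ^ 3 ^ n) s = s} ∧
      Nat.card {s : Sel // 3 • s = 0 ∧ W.conjH1 3 κ.kerSubgroup (γ ^ 3 ^ n) s = s} < 3 ^ 3 ^ n

end Vocabulary

/-! ## §1 The two WEAKER pieces of the root split (the crux restricted to one bucket each) -/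

/-- **PieceB** — `TwinAlgMuZeroAtThree` VERBATIM on bucket B only (`Mult W′ 3 ∧ 3 ∤ v₃(Δ′_min)` in place of the
disjunction). Tag WEAKER. -/
def PieceB : Prop :=
  ∀ (W' : WeierstrassCurve ℚ) [W'.IsElliptic] [W'.IsGloballyMinimal] (N' : ℕ) [NeZero N'] (K : Type) [Field K]
    [NumberField K],
    Rank1Residual.Mult W' 3 → ¬ 3 ∣ padicValInt 3 W'.minimalDiscriminantInt →
    W'.HasSurjectiveModNGaloisRep 3 → W'.conductorNorm ℤ = N' → IsImaginaryQuadratic K →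
    SatisfiesHeegnerHypothesis N' K → Odd (NumberField.discr K) →
    ∀ (κ : ZpExtension K 3), κ.IsAnticyclotomic →
    ∀ (γ : absoluteGaloisGroup K) [Fact (κ.IsTopGenerator γ)] (𝔭 : HeightOneSpectrum (𝓞 K)),
      ((3 : ℕ) : 𝓞 K) ∈ 𝔭.asIdeal → 𝔭.asIdeal.ramificationIdx (𝓞 ℚ) = 1 → 𝔭.asIdeal.inertiaDeg (𝓞 ℚ) = 1 →
    ∀ (𝔭' : HeightOneSpectrum (𝓞 K)), ((3 : ℕ) : 𝓞 K) ∈ 𝔭'.asIdeal → 𝔭' ≠ 𝔭 →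
      Module.IsTorsion (IwasawaAlgebra 3) (XAc (W'.baseChange K) 3 κ 𝔭' ∅ γ) ∧
        ∃ g' : UnrSeries 3,
          (XAc.charIdeal (W'.baseChange K) 3 κ 𝔭' ∅ γ).map (PowerSeries.map (Halves.toUnr 3)) = Ideal.span {g'} ∧
            ∃ i : ℕ, ‖((PowerSeries.coeff i g' : unrIntegers 3) : ℂ_[3])‖ = 1

/-- **PieceC0** — `TwinAlgMuZeroAtThree` VERBATIM on bucket C₀ only (`GoodSS W′ 3 ∧ a₃(W′) = 0`). Tag WEAKER. -/
def PieceC0 : Prop :=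
  ∀ (W' : WeierstrassCurve ℚ) [W'.IsElliptic] [W'.IsGloballyMinimal] (N' : ℕ) [NeZero N'] (K : Type) [Field K]
    [NumberField K],
    Rank1Residual.GoodSS W' 3 → W'.frobeniusTrace 3 = 0 →
    W'.HasSurjectiveModNGaloisRep 3 → W'.conductorNorm ℤ = N' → IsImaginaryQuadratic K →
    SatisfiesHeegnerHypothesis N' K → Odd (NumberField.discr K) →
    ∀ (κ : ZpExtension K 3), κ.IsAnticyclotomic →
    ∀ (γ : absoluteGaloisGroup K) [Fact (κ.IsTopGenerator γ)] (𝔭 : HeightOneSpectrum (𝓞 K)),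
      ((3 : ℕ) : 𝓞 K) ∈ 𝔭.asIdeal → 𝔭.asIdeal.ramificationIdx (𝓞 ℚ) = 1 → 𝔭.asIdeal.inertiaDeg (𝓞 ℚ) = 1 →
    ∀ (𝔭' : HeightOneSpectrum (𝓞 K)), ((3 : ℕ) : 𝓞 K) ∈ 𝔭'.asIdeal → 𝔭' ≠ 𝔭 →
      Module.IsTorsion (IwasawaAlgebra 3) (XAc (W'.baseChange K) 3 κ 𝔭' ∅ γ) ∧
        ∃ g' : UnrSeries 3,
          (XAc.charIdeal (W'.baseChange K) 3 κ 𝔭' ∅ γ).map (PowerSeries.map (Halves.toUnr 3)) = Ideal.span {g'} ∧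
            ∃ i : ℕ, ‖((PowerSeries.coeff i g' : unrIntegers 3) : ℂ_[3])‖ = 1

/-- ROOT SPLIT (proved): the two bucket pieces give the crux BY NAME — a case split on the crux's own guard. -/
theorem TwinAlgMuZeroAtThree_of_pieces (hB : PieceB) (hC : PieceC0) :
    Summit.BirchSwinnertonDyer.BirchSwinnertonDyer.Theses.UniversalToricDescent.TwinAlgMuZeroAtThree := by
  intro W' _ _ N' _ K _ _ Dt' hguard hsurj hN hK hH hd κ hκ γ _ 𝔭 h𝔭 he hf 𝔭' h𝔭' hne
  rcases hguard with ⟨hm, hv⟩ | ⟨hss, ha⟩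
  · exact hB W' N' K hm hv hsurj hN hK hH hd κ hκ γ 𝔭 h𝔭 he hf 𝔭' h𝔭' hne
  · exact hC W' N' K hss ha hsurj hN hK hH hd κ hκ γ 𝔭 h𝔭 he hf 𝔭' h𝔭' hne

/-! ## §2 Bucket B (multiplicative très ramifié at 3): three stubs -/

/-- **K1_B — `(β)`-pair supply on bucket B.** For every bucket-B datum of the crux there is an embedding `jbar` and a
Heegner family `F` of `3`-power conductors for `(E′, N′, K, κ)` which is GUARDED (`3 ∤ c(φ′)`, the Manin-type constant
of its parametrisation datum), `a₃`-NORM-COHERENT, and locally `3`-indivisible at some layer at `𝔭` AND at `𝔭′`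
(g51's `LocalIndivisibleLayer`). Tags: UNDECIDED · leaf INSTRUMENTABLE (Q-BETA-1/2, engine `serre-tate-coleman-cube`).
Why it might fail: no explicit reciprocity law at `3 ∥ N′` in print; the unit-root/Dwork engine (g56) is a sketch. -/
def BetaPairMultThree : Prop :=
  ∀ (W' : WeierstrassCurve ℚ) [W'.IsElliptic] [W'.IsGloballyMinimal] (N' : ℕ) [NeZero N'] (K : Type) [Field K]
    [NumberField K],
    Rank1Residual.Mult W' 3 → ¬ 3 ∣ padicValInt 3 W'.minimalDiscriminantInt →
    W'.HasSurjectiveModNGaloisRep 3 → W'.conductorNorm ℤ = N' → IsImaginaryQuadratic K →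
    SatisfiesHeegnerHypothesis N' K → Odd (NumberField.discr K) →
    ∀ (κ : ZpExtension K 3), κ.IsAnticyclotomic →
    ∀ (𝔭 : HeightOneSpectrum (𝓞 K)),
      ((3 : ℕ) : 𝓞 K) ∈ 𝔭.asIdeal → 𝔭.asIdeal.ramificationIdx (𝓞 ℚ) = 1 → 𝔭.asIdeal.inertiaDeg (𝓞 ℚ) = 1 →
      ∃ (jbar : AlgebraicClosure K →+* ℂ) (F : HeegnerFamily N' W' K κ jbar),
        ¬ (3 : ℤ) ∣ F.Dt.c ∧ IsNormCoherentMult F (W'.frobeniusTrace 3) ∧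
          LocalIndivisibleLayer W' K κ jbar F 𝔭

/-- **R1_B — the RESIDUAL Ω-ADIC KOLYVAGIN SYSTEM at multiplicative 3 (the card's lever).** For a guarded,
`a₃`-norm-coherent Heegner family with `(β)` at `𝔭` (so `κ̄₁ ≠ 0` in `H¹(K, T_Ω)`), the classical Selmer group
`Sel(K_∞, E′[3^∞])` (tree `selmerInfty`, Kummer conditions; = Greenberg's up to a finite `[3]`-error at the finitely
many `w ∣ 3`) has residual Ω-corank `≤ 1`: `rank_Λ X(E′/K_∞) + #μ-summands ≤ 1`. Howard 2004 Thm 2.6.1 over the DVR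
`Ω = 𝔽₃⟦T⟧`. Tags: UNDECIDED · leaf IDEA = card `residual-omega-kolyvagin` (this round).
Why it might fail: the residual local condition at `v ∣ 3` (image of `H¹(K_v, Fil ⊗ Ω(Ψ))`) must be self-dual AND
cartesian AND within finite `[3]`-error of the reduction of the Kummer condition along the ramified local tower; the
Kolyvagin derivative classes at `3 ∥ N′` use mixed-conductor Heegner points (Cornut–Vatsal-type input unported). -/
def ResidualKolyvaginMultThree : Prop :=
  ∀ (W' : WeierstrassCurve ℚ) [W'.IsElliptic] [W'.IsGloballyMinimal] (N' : ℕ) [NeZero N'] (K : Type) [Field K]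
    [NumberField K],
    Rank1Residual.Mult W' 3 → ¬ 3 ∣ padicValInt 3 W'.minimalDiscriminantInt →
    W'.HasSurjectiveModNGaloisRep 3 → W'.conductorNorm ℤ = N' → IsImaginaryQuadratic K →
    SatisfiesHeegnerHypothesis N' K → Odd (NumberField.discr K) →
    ∀ (κ : ZpExtension K 3), κ.IsAnticyclotomic →
    ∀ (γ : absoluteGaloisGroup K) [Fact (κ.IsTopGenerator γ)] (𝔭 : HeightOneSpectrum (𝓞 K)),
      ((3 : ℕ) : 𝓞 K) ∈ 𝔭.asIdeal → 𝔭.asIdeal.ramificationIdx (𝓞 ℚ) = 1 → 𝔭.asIdeal.inertiaDeg (𝓞 ℚ) = 1 →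
    ∀ (jbar : AlgebraicClosure K →+* ℂ) (F : HeegnerFamily N' W' K κ jbar),
      ¬ (3 : ℤ) ∣ F.Dt.c → IsNormCoherentMult F (W'.frobeniusTrace 3) →
      LocalIndivisibleLayer W' K κ jbar F 𝔭 →
        ResidualCorankLeOne (W'.baseChange K) κ ((W'.baseChange K).selmerInfty κ) γ

/-- **T1_B — μ-only Poitou–Tate transfer on bucket B.** `(β)` at `𝔭` for a guarded coherent family and residual
Ω-corank `≤ 1` of `Sel(K_∞, E′[3^∞])` imply (τ-symmetry `coker loc_𝔭′|𝔖 ≅ (coker loc_𝔭|𝔖)^ι` pays for `𝔭′`) that `Sel_(∅ at 𝔭, 0 at 𝔭′)(K_∞, E′[3^∞])[3]` (tree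
`selmerAc … 𝔭′ ∅`: strict above `𝔭′`, relaxed above `𝔭`) has a layer with fewer than `3^{3ⁿ}` invariants (`OneSmallLayer`).
Tags: WEAKER (implication between Selmer data; μ-part of the char-ideal transfer formula) · leaf ATTACKABLE
(`poitouTate_selmerStructure_duality_holds` p624636, `freeRankOneIndivisible` p720585, one-layer criterion p725052).
Why it might fail: the `[3]`-error between Kummer and Greenberg conditions at `w ∣ 3` over `K_∞` must be FINITE
(uses `E′(K_∞)[3] = 0`, fine for `ρ̄` onto) — a cofinitely-generated-but-infinite error would break `OneSmallLayer`. -/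
def ResidualTransferMultThree : Prop :=
  ∀ (W' : WeierstrassCurve ℚ) [W'.IsElliptic] [W'.IsGloballyMinimal] (N' : ℕ) [NeZero N'] (K : Type) [Field K]
    [NumberField K],
    Rank1Residual.Mult W' 3 → ¬ 3 ∣ padicValInt 3 W'.minimalDiscriminantInt →
    W'.HasSurjectiveModNGaloisRep 3 → W'.conductorNorm ℤ = N' → IsImaginaryQuadratic K →
    SatisfiesHeegnerHypothesis N' K → Odd (NumberField.discr K) →
    ∀ (κ : ZpExtension K 3), κ.IsAnticyclotomic →
    ∀ (γ : absoluteGaloisGroup K) [Fact (κ.IsTopGenerator γ)] (𝔭 : HeightOneSpectrum (𝓞 K)),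
      ((3 : ℕ) : 𝓞 K) ∈ 𝔭.asIdeal → 𝔭.asIdeal.ramificationIdx (𝓞 ℚ) = 1 → 𝔭.asIdeal.inertiaDeg (𝓞 ℚ) = 1 →
    ∀ (𝔭' : HeightOneSpectrum (𝓞 K)), ((3 : ℕ) : 𝓞 K) ∈ 𝔭'.asIdeal → 𝔭' ≠ 𝔭 →
    ∀ (jbar : AlgebraicClosure K →+* ℂ) (F : HeegnerFamily N' W' K κ jbar),
      ¬ (3 : ℤ) ∣ F.Dt.c → IsNormCoherentMult F (W'.frobeniusTrace 3) →
      LocalIndivisibleLayer W' K κ jbar F 𝔭 →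
      ResidualCorankLeOne (W'.baseChange K) κ ((W'.baseChange K).selmerInfty κ) γ →
        OneSmallLayer (W'.baseChange K) κ (selmerAc (W'.baseChange K) 3 κ 𝔭' ∅) γ

/-- stub K1_B (registered). -/
theorem stub_betaPairMult : BetaPairMultThree := by
  sorry

/-- stub R1_B (registered; the lever). -/
theorem stub_residualKolyvaginMult : ResidualKolyvaginMultThree := by
  sorry

/-- stub T1_B (registered). -/
theorem stub_residualTransferMult : ResidualTransferMultThree := by
  sorry

/-- COMPOSITION on bucket B (proved, no sorry): K1_B → R1_B → T1_B → PieceB, through the LANDED one-layer criterion. -/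
theorem pieceB_of (hK1 : BetaPairMultThree) (hR1 : ResidualKolyvaginMultThree)
    (hT1 : ResidualTransferMultThree) : PieceB := by
  intro W' _ _ N' _ K _ _ hm hv hsurj hN hK hH hd κ hκ γ _ 𝔭 h𝔭 he hf 𝔭' h𝔭' hne
  obtain ⟨jbar, F, hc, hcoh, hβ⟩ := hK1 W' N' K hm hv hsurj hN hK hH hd κ hκ 𝔭 h𝔭 he hf
  have hR := hR1 W' N' K hm hv hsurj hN hK hH hd κ hκ γ 𝔭 h𝔭 he hf jbar F hc hcoh hβ
  obtain ⟨n, hfin, hlt⟩ :=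
    hT1 W' N' K hm hv hsurj hN hK hH hd κ hκ γ 𝔭 h𝔭 he hf 𝔭' h𝔭' hne jbar F hc hcoh hβ hR
  exact Theorems.UniversalToricDescentOneLayerCriterion.isTorsion_and_exists_generator_of_natCard_layerInvariants_lt
    (W'.baseChange K) 3 κ 𝔭' ∅ γ Set.finite_empty n hfin hlt

/-! ## §3 Bucket C₀ (good supersingular, a₃ = 0): the three SIGNED stubs -/

/-- **K1_C — signed `(β)`-pair supply on bucket C₀.** A guarded TRACE-COHERENT Heegner family and ONE sign `ε` with
g57's `SignedLayerIndivisible` (infinitely many layers of parity `ε` locally `3`-indivisible) at `𝔭` — g57's engine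
`SignedNewtonBeta.BetaEngineGoodSSApZeroThree` applied to an existing guarded trace-coherent family. Tags: UNDECIDED · leaf
INSTRUMENTABLE (Q-BETA-C₀ of g57 on 17a1/ℚ(√−35); engine card `height-two-newton-signed-beta`).
Why it might fail: the signed explicit reciprocity law is printed for `p > 3` only (Castella–Wan Thm 5.6). -/
def BetaPairGoodSSThree : Prop :=
  ∀ (W' : WeierstrassCurve ℚ) [W'.IsElliptic] [W'.IsGloballyMinimal] (N' : ℕ) [NeZero N'] (K : Type) [Field K]
    [NumberField K],
    Rank1Residual.GoodSS W' 3 → W'.frobeniusTrace 3 = 0 →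
    W'.HasSurjectiveModNGaloisRep 3 → W'.conductorNorm ℤ = N' → IsImaginaryQuadratic K →
    SatisfiesHeegnerHypothesis N' K → Odd (NumberField.discr K) →
    ∀ (κ : ZpExtension K 3), κ.IsAnticyclotomic →
    ∀ (𝔭 : HeightOneSpectrum (𝓞 K)),
      ((3 : ℕ) : 𝓞 K) ∈ 𝔭.asIdeal → 𝔭.asIdeal.ramificationIdx (𝓞 ℚ) = 1 → 𝔭.asIdeal.inertiaDeg (𝓞 ℚ) = 1 →
      ∃ (jbar : AlgebraicClosure K →+* ℂ) (F : HeegnerFamily N' W' K κ jbar) (ε : ℤˣ),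
        ¬ (3 : ℤ) ∣ F.Dt.c ∧ F.IsTraceCoherentApZero ∧
          SignedLayerIndivisible W' K κ jbar F 𝔭 ε

/-- **R1_C — the SIGNED residual Ω-adic Kolyvagin system at supersingular 3.** For a guarded trace-coherent family
and a sign `ε` with signed `(β)` at `𝔭`, the discrete SIGNED Selmer group `Sel_(ε,ε)(K_∞, E′[3^∞])` (tree
`AcSigned.selmer … ∅ (fun _ ↦ .sgn ε)`, B.-D. Kim / Castella–Wan Def. 5.1 conditions at both primes over 3) has
residual Ω-corank `≤ 1`. Castella–Wan Thm A.4/A.5 run over `Ω = 𝔽₃⟦T⟧` (signed classes `z^ε` reduced mod 3;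
B.-D. Kim's self-duality of `ℋ^ε`). Tags: UNDECIDED · leaf IDEA = card `residual-omega-kolyvagin` (this round).
Why it might fail: `ℋ^ε_w ⊗ 𝔽₃` must be a cartesian self-dual residual local condition (B.-D. Kim Prop 3.2 needs
no `p`-torsion in the local points of the tower — port at `p = 3`, `[Edi97]`-type image input at `3`). -/
def ResidualKolyvaginGoodSSThree : Prop :=
  ∀ (W' : WeierstrassCurve ℚ) [W'.IsElliptic] [W'.IsGloballyMinimal] (N' : ℕ) [NeZero N'] (K : Type) [Field K]
    [NumberField K],
    Rank1Residual.GoodSS W' 3 → W'.frobeniusTrace 3 = 0 →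
    W'.HasSurjectiveModNGaloisRep 3 → W'.conductorNorm ℤ = N' → IsImaginaryQuadratic K →
    SatisfiesHeegnerHypothesis N' K → Odd (NumberField.discr K) →
    ∀ (κ : ZpExtension K 3), κ.IsAnticyclotomic →
    ∀ (γ : absoluteGaloisGroup K) [Fact (κ.IsTopGenerator γ)] (𝔭 : HeightOneSpectrum (𝓞 K)),
      ((3 : ℕ) : 𝓞 K) ∈ 𝔭.asIdeal → 𝔭.asIdeal.ramificationIdx (𝓞 ℚ) = 1 → 𝔭.asIdeal.inertiaDeg (𝓞 ℚ) = 1 →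
    ∀ (jbar : AlgebraicClosure K →+* ℂ) (F : HeegnerFamily N' W' K κ jbar) (ε : ℤˣ),
      ¬ (3 : ℤ) ∣ F.Dt.c → F.IsTraceCoherentApZero →
      SignedLayerIndivisible W' K κ jbar F 𝔭 ε →
        ResidualCorankLeOne (W'.baseChange K) κ
          (AcSigned.selmer (W'.baseChange K) 3 κ ∅ (fun _ ↦ AcSigned.PCond.sgn ε)) γ

/-- **T1_C — signed μ-only Poitou–Tate transfer on bucket C₀.** Signed `(β)` at `𝔭` and residual Ω-corank `≤ 1` of
`Sel_(ε,ε)` give a small layer of `Sel_(∅ at 𝔭, 0 at 𝔭′)[3]`: the μ-part of Castella–Wan 2024 §5's passage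
`(±,±) ↔ (rel,str)` (`char X_(rel,str) = char X_(±,tors) · char(H¹_±(K_𝔭,𝕋)/loc Sel_±)²`-shape). Tags: WEAKER ·
leaf ATTACKABLE (Poitou–Tate p624636 + `AcSigned.selmer` vocabulary + one-layer criterion p725052).
Why it might fail: freeness/rank one of the signed local module `H¹_ε(K_𝔭, 𝕋^ac)` at `p = 3` (Castella–Wan Lemma
4.? for `p > 3`) is a port. -/
def ResidualTransferGoodSSThree : Prop :=
  ∀ (W' : WeierstrassCurve ℚ) [W'.IsElliptic] [W'.IsGloballyMinimal] (N' : ℕ) [NeZero N'] (K : Type) [Field K]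
    [NumberField K],
    Rank1Residual.GoodSS W' 3 → W'.frobeniusTrace 3 = 0 →
    W'.HasSurjectiveModNGaloisRep 3 → W'.conductorNorm ℤ = N' → IsImaginaryQuadratic K →
    SatisfiesHeegnerHypothesis N' K → Odd (NumberField.discr K) →
    ∀ (κ : ZpExtension K 3), κ.IsAnticyclotomic →
    ∀ (γ : absoluteGaloisGroup K) [Fact (κ.IsTopGenerator γ)] (𝔭 : HeightOneSpectrum (𝓞 K)),
      ((3 : ℕ) : 𝓞 K) ∈ 𝔭.asIdeal → 𝔭.asIdeal.ramificationIdx (𝓞 ℚ) = 1 → 𝔭.asIdeal.inertiaDeg (𝓞 ℚ) = 1 →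
    ∀ (𝔭' : HeightOneSpectrum (𝓞 K)), ((3 : ℕ) : 𝓞 K) ∈ 𝔭'.asIdeal → 𝔭' ≠ 𝔭 →
    ∀ (jbar : AlgebraicClosure K →+* ℂ) (F : HeegnerFamily N' W' K κ jbar) (ε : ℤˣ),
      ¬ (3 : ℤ) ∣ F.Dt.c → F.IsTraceCoherentApZero →
      SignedLayerIndivisible W' K κ jbar F 𝔭 ε →
      ResidualCorankLeOne (W'.baseChange K) κ
          (AcSigned.selmer (W'.baseChange K) 3 κ ∅ (fun _ ↦ AcSigned.PCond.sgn ε)) γ →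
        OneSmallLayer (W'.baseChange K) κ (selmerAc (W'.baseChange K) 3 κ 𝔭' ∅) γ

/-- stub K1_C (registered). -/
theorem stub_betaPairGoodSS : BetaPairGoodSSThree := by
  sorry

/-- stub R1_C (registered; the lever, signed). -/
theorem stub_residualKolyvaginGoodSS : ResidualKolyvaginGoodSSThree := by
  sorry

/-- stub T1_C (registered). -/
theorem stub_residualTransferGoodSS : ResidualTransferGoodSSThree := by
  sorry

/-- COMPOSITION on bucket C₀ (proved, no sorry): K1_C → R1_C → T1_C → PieceC0. -/
theorem pieceC0_of (hK1 : BetaPairGoodSSThree) (hR1 : ResidualKolyvaginGoodSSThree)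
    (hT1 : ResidualTransferGoodSSThree) : PieceC0 := by
  intro W' _ _ N' _ K _ _ hss ha hsurj hN hK hH hd κ hκ γ _ 𝔭 h𝔭 he hf 𝔭' h𝔭' hne
  obtain ⟨jbar, F, ε, hc, hcoh, hβ⟩ := hK1 W' N' K hss ha hsurj hN hK hH hd κ hκ 𝔭 h𝔭 he hf
  have hR := hR1 W' N' K hss ha hsurj hN hK hH hd κ hκ γ 𝔭 h𝔭 he hf jbar F ε hc hcoh hβ
  obtain ⟨n, hfin, hlt⟩ :=
    hT1 W' N' K hss ha hsurj hN hK hH hd κ hκ γ 𝔭 h𝔭 he hf 𝔭' h𝔭' hne jbar F ε hc hcoh hβ hR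
  exact Theorems.UniversalToricDescentOneLayerCriterion.isTorsion_and_exists_generator_of_natCard_layerInvariants_lt
    (W'.baseChange K) 3 κ 𝔭' ∅ γ Set.finite_empty n hfin hlt

/-! ## §4 The concluding composition (kernel-checked): six stubs ⟹ the crux BY NAME -/

/-- **`TwinAlgMuZeroAtThree_of`**: the six registered stubs imply the route decl
`Summit.BirchSwinnertonDyer.BirchSwinnertonDyer.Theses.UniversalToricDescent.TwinAlgMuZeroAtThree` (no sorry here). -/
theorem TwinAlgMuZeroAtThree_of :
    BetaPairMultThree → ResidualKolyvaginMultThree → ResidualTransferMultThree →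
    BetaPairGoodSSThree → ResidualKolyvaginGoodSSThree → ResidualTransferGoodSSThree →
      Summit.BirchSwinnertonDyer.BirchSwinnertonDyer.Theses.UniversalToricDescent.TwinAlgMuZeroAtThree :=
  fun hK1 hR1 hT1 hK1' hR1' hT1' ↦
    TwinAlgMuZeroAtThree_of_pieces (pieceB_of hK1 hR1 hT1) (pieceC0_of hK1' hR1' hT1')

/-- The crux from the stubs (sorries live ONLY inside the six `stub_*`). -/
theorem TwinAlgMuZeroAtThree_of_stubs :
    Summit.BirchSwinnertonDyer.BirchSwinnertonDyer.Theses.UniversalToricDescent.TwinAlgMuZeroAtThree :=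
  TwinAlgMuZeroAtThree_of stub_betaPairMult stub_residualKolyvaginMult stub_residualTransferMult
    stub_betaPairGoodSS stub_residualKolyvaginGoodSS stub_residualTransferGoodSS

end Summit.BirchSwinnertonDyer.BirchSwinnertonDyer.Cruxes.TwinAlgMuZeroAtThree.ResidualOmegaKolyvagin
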